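import Summits.AnomalousDissipation.AnomalousDissipation.Theorems.QuarticGate.Negative.LevelCeiling

/-!
# Sketch (crux-ideate r1, ideator 3, gen 2) — crux `ResolvedDissipation` (stmt-AnomalousDissipation-14284)

First lemmas / transfer targets of the idea card `critical-weight-flux-pincer`, stated over existing
declarations (they are `Prop`s to be proved by a line, not claimed here), plus the one genuinely
elementary step of the line proved outright (`antitone_pigeonhole`: a non-increasing sequence under a
summable majorant decays like `A/(K+1)` — this is what turns a mere BOUND on the weighted flux budget
into an `N`-uniform resolution SCHEDULE).

v2 (same session): all Littlewood–Paley objects are SMOOTH (radial symbol `χ(|k|/λ)` with the tree's bump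
`Torus.galerkinCutoff`), because flux locality is FALSE for the sharp spherical cutoff (sweeping: a triad
`(p, q, k)` with `|p| = 1`, `|q| < 2^K < |k|` transfers energy across the sharp sphere at rate `∝ 2^K`,
unsuppressed; the smooth symbol gains `|p|/2^K`). The crux's sharp tail enstrophy is recovered by the
sandwich `Z_{2^{K+1}} ≤ Y − ‖∇S_{2^K}u‖² ≤ Z_{2^{K-1}}` (χ = 1 on `|k| ≤ 2^K`, χ = 0 on `|k| ≥ 2^{K+1}`).
-/

noncomputable section

set_option linter.dupNamespace false

namespace Summit.AnomalousDissipation.AnomalousDissipation.Cruxes.ResolvedDissipation.Ideate3G2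

open MeasureTheory Filter Topology
open scoped ENNReal InnerProductSpace RealInnerProductSpace
open Literature.Analysis.FunctionSpaces Literature.Analysis.FluidPDE
open Summit.AnomalousDissipation.AnomalousDissipation.Theses.MomentParity
open Summit.AnomalousDissipation.AnomalousDissipation.Theorems.QuarticGate.Negative

/-- The 3-torus. -/
abbrev T3 : Type := UnitAddTorus (Fin 3)
/-- Velocity values. -/
abbrev R3 : Type := EuclideanSpace ℝ (Fin 3)
/-- The energy space `H = L²_σ(T³)` of the crux. -/
abbrev H3 : Type := ↥(Torus.energySpace (Fin 3))

local notation "L2T3" => Lp (EuclideanSpace ℝ (Fin 3)) 2 (volume : Measure (UnitAddTorus (Fin 3)))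

/-- The underlying (a.e.-class representative) field of a state `u ∈ H`. -/
def fld (u : H3) : T3 → R3 := ((u.1 : L2T3) : T3 → R3)

/-- Stationarity at every order for Galerkin NS at `(ν, f)`, level `N` (the crux's hypothesis, verbatim). -/
def IsStationary (ν : ℝ) (f : T3 → R3) (N : ℕ) (μ : Measure H3) : Prop :=
  ∀ (m : ℕ) (g : Fin m → T3 → R3) (P : MvPolynomial (Fin m) ℝ), (∀ i, IsBandTest N (g i)) →
    Integrable (fun u => Torus.nsGeneratorPairing ν f u (polyGrad g P u)) μ ∧
      ∫ u, Torus.nsGeneratorPairing ν f u (polyGrad g P u) ∂μ = 0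

/-- The four hypotheses of `ResolvedDissipation` on a pair `(N, μ)` ("RD-admissible law"). -/
def IsAdmissible (ν : ℝ) (f : T3 → R3) (R : ℝ) (N : ℕ) (μ : Measure H3) : Prop :=
  IsProbabilityMeasure μ ∧ (∀ᵐ u ∂μ, IsLevel N u) ∧ (∀ᵐ u ∂μ, ‖u‖ ≤ R) ∧ IsStationary ν f N μ

/-- Enstrophy `Y(u) = ‖∇u‖²` (spectral, as in the crux). -/
def enstrophy (u : H3) : ℝ≥0∞ := Torus.eGradNormSq (fld u)

/-- Tail enstrophy beyond the cutoff `K`: `Z_K(u) = ‖∇(u − P_K u)‖² = Σ_{|k|>K} 4π²|k|²|û(k)|²`. -/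
def tailEnstrophy (K : ℕ) (u : H3) : ℝ≥0∞ := Torus.eGradNormSq (fld u - Torus.fourierTruncate K (fld u))

/-- Smooth radial Littlewood–Paley symbol `χ(|k|/λ)` (`χ = Torus.galerkinCutoff`: `1` on `|t| ≤ 1`, `0` on `|t| ≥ 2`;
junk `χ(|k|/0) = χ(0) = 1` at `λ = 0`, harmless). -/
def lpSymbol (lam : ℝ) (k : Fin 3 → ℤ) : ℝ :=
  (Torus.galerkinCutoff : ℝ → ℝ) (Real.sqrt (Torus.freqNormSq k) / lam)

/-- Smooth low-pass `S_λ v = Re Σ_k χ(|k|/λ) v̂(k) e^{2πik·x}` (a trigonometric polynomial carried by `|k| ≤ 2λ`). -/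
def smoothLowPass (lam : ℕ) (v : T3 → R3) : T3 → R3 :=
  Torus.realTrigPoly (Torus.freqBall (2 * lam)) fun k =>
    ((lpSymbol lam k : ℝ) : ℂ) • UnitAddTorus.mFourierCoeff (EuclideanSpace.complexify ∘ v) k

/-- Smooth dyadic block `Δ_j v = S_{2^j} v − S_{2^j/2} v` (symbol supported in `2^{j-1} ≤ |k| ≤ 2^{j+1}`). -/
def dyadicPart (j : ℕ) (v : T3 → R3) : T3 → R3 :=
  smoothLowPass (2 ^ j) v - smoothLowPass (2 ^ j / 2) v

/-- `‖Δ_j v‖_∞`. -/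
def shellSup (j : ℕ) (v : T3 → R3) : ℝ≥0∞ := eLpNorm (dyadicPart j v) ∞ volume
/-- `‖Δ_j v‖_{L³}`. -/
def shellL3 (j : ℕ) (v : T3 → R3) : ℝ≥0∞ := eLpNorm (dyadicPart j v) 3 volume
/-- `‖Δ_j v‖_{L²}`. -/
def shellL2 (j : ℕ) (v : T3 → R3) : ℝ≥0∞ := eLpNorm (dyadicPart j v) 2 volume
/-- Shell enstrophy `Z_j(v) = ‖∇Δ_j v‖²`. -/
def shellEnstrophy (j : ℕ) (v : T3 → R3) : ℝ≥0∞ := Torus.eGradNormSq (dyadicPart j v)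

/-- The CRITICAL WEIGHT: the `B^{-1}_{∞,∞}`-type seminorm `sup_j 2^{-j} ‖Δ_j v‖_∞`
(= `ν ×` the largest local Reynolds number over dyadic scales; scale-invariant under NS scaling). -/
def reynoldsWeight (v : T3 → R3) : ℝ≥0∞ := ⨆ j : ℕ, ((2 : ℝ≥0∞) ^ j)⁻¹ * shellSup j v

/-- Smooth Littlewood–Paley energy flux through `2^K` (CCFS (10)–(11)):
`Π_K(u) = ∫ (u ⊗ u) : ∇S²_{2^K} u = ∫ S(u ⊗ u) : ∇S u` (the crux's `inertialPairing` with the band-limited smooth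
solenoidal test field `S²_{2^K} u` — exactly the inertial part of the stationarity row on `½‖S_{2^K} u‖²`). -/
def flux (K : ℕ) (u : H3) : ℝ :=
  Torus.inertialPairing (u.1 : L2T3) (smoothLowPass (2 ^ K) (smoothLowPass (2 ^ K) (fld u)))

/-- The smooth resolved enstrophy defect `Y(u) − ‖∇S_{2^K} u‖²`, sandwiched between the crux's sharp tails
`Z_{2^{K+1}}(u) ≤ · ≤ Z_{2^{K-1}}(u)`. -/
def smoothTail (K : ℕ) (u : H3) : ℝ≥0∞ := enstrophy u - Torus.eGradNormSq (smoothLowPass (2 ^ K) (fld u))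

/-- The CCFS locality kernel `2^{-(2/3)|j − K|}` (arXiv:0704.0759, Prop. 3.2, kernel `K(q)`). -/
def locKernel (j K : ℕ) : ℝ≥0∞ := (2 : ℝ≥0∞) ^ (-(2 / 3 : ℝ) * |((j : ℝ) - (K : ℝ))|)

/-- **Flux locality** (Cheskidov–Constantin–Friedlander–Shvydkoy 2008, arXiv:0704.0759 Prop. 3.2 with the Hölder step
`(kern ∗ d²)^{3/2} ≤ κ₀^{1/2} kern ∗ d³`, on level-`N` fields, SMOOTH blocks): `|Π_K(u)| ≤ C Σ_j 2^{-(2/3)|j−K|} 2^j ‖Δ_j u‖³_{L³}`.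
(Literature fact to vendor on `T³`; printed on `ℝ³`. NOT true for sharp spherical cutoffs — sweeping.) -/
def FluxLocality : Prop :=
  ∃ C : ℝ≥0∞, C ≠ ⊤ ∧ ∀ (N : ℕ) (u : H3), IsLevel N u → ∀ K : ℕ,
    ENNReal.ofReal |flux K u| ≤ C * ∑' j : ℕ, locKernel j K * (2 : ℝ≥0∞) ^ j * shellL3 j (fld u) ^ 3

/-- **Transfer target C⁺ (critical face): Reynolds-weighted mean enstrophy is `N`-uniformly bounded**
over RD-admissible laws: `sup_{N,μ} ∫ (sup_j 2^{-j}‖Δ_j u‖_∞) · ‖∇u‖² dμ < ∞`. Energy-class SCALING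
(the weight is scale-invariant), implied by no known a-priori bound, implies RD (`TransferCritical`). -/
def ReynoldsWeightedEnstrophy : Prop :=
  ∀ f : T3 → R3, Torus.IsSmooth f → Torus.IsDivFree f → Torus.HasZeroMean f → ∀ ν : ℝ, 0 < ν → ∀ R : ℝ,
    ∃ C : ℝ≥0∞, C ≠ ⊤ ∧ ∀ (N : ℕ) (μ : Measure H3), IsAdmissible ν f R N μ →
      ∫⁻ u, reynoldsWeight (fld u) * enstrophy u ∂μ ≤ C

/-- **Type-I ceiling on the supports** (a.s. critical bound, uniform in `N`): the strongest natural
sufficient condition — compatible with Type-I (Leray-scaling) quasi-singular events, cf.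
Leslie–Shvydkoy arXiv:1606.02363 Thm. 1.2 (Type-I blow-up satisfies the energy equality). -/
def TypeOneCeiling : Prop :=
  ∀ f : T3 → R3, Torus.IsSmooth f → Torus.IsDivFree f → Torus.HasZeroMean f → ∀ ν : ℝ, 0 < ν → ∀ R : ℝ,
    ∃ M : ℝ≥0∞, M ≠ ⊤ ∧ ∀ (N : ℕ) (μ : Measure H3), IsAdmissible ν f R N μ →
      ∀ᵐ u ∂μ, reynoldsWeight (fld u) ≤ M

/-- The lossy moment corollary: a `5/4`-moment of the enstrophy (via `‖v‖_{B^{-1}_{∞,∞}} ≲ ‖v‖_{Ḣ^{1/2}}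
≤ |v|^{1/2}‖∇v‖^{1/2}`) — one quarter of a power below the `3/2` of card `half-derivative-cutoff-flux`. -/
def FiveFourthsMoment : Prop :=
  ∀ f : T3 → R3, Torus.IsSmooth f → Torus.IsDivFree f → Torus.HasZeroMean f → ∀ ν : ℝ, 0 < ν → ∀ R : ℝ,
    ∃ C : ℝ≥0∞, C ≠ ⊤ ∧ ∀ (N : ℕ) (μ : Measure H3), IsAdmissible ν f R N μ →
      ∫⁻ u, enstrophy u ^ (5 / 4 : ℝ) ∂μ ≤ C

/-- **Transfer target (volumetric face): a floor `D > 1` on the ensemble intermittency dimension of high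
shells** (Cheskidov–Shvydkoy saturation `‖Δ_j u‖_{L³} ≲ 2^{j(3−D)/6}‖Δ_j u‖_{L²}`, cubed and averaged):
leak carriers must be filamentary or point-like (`D ≤ 1`); sheets (`D = 2`) cannot leak whatever their
local Reynolds number. -/
def VolumetricFloor : Prop :=
  ∀ f : T3 → R3, Torus.IsSmooth f → Torus.IsDivFree f → Torus.HasZeroMean f → ∀ ν : ℝ, 0 < ν → ∀ R : ℝ,
    ∃ D : ℝ, 1 < D ∧ ∃ C : ℝ≥0∞, C ≠ ⊤ ∧ ∃ j₀ : ℕ, ∀ (N : ℕ) (μ : Measure H3), IsAdmissible ν f R N μ →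
      ∀ j : ℕ, j₀ ≤ j →
        ∫⁻ u, shellL3 j (fld u) ^ 3 ∂μ ≤ C * (2 : ℝ≥0∞) ^ ((3 - D) / 2 * (j : ℝ)) * ∫⁻ u, shellL2 j (fld u) ^ 3 ∂μ

/-- First lemma (critical face): flux locality + Reynolds-weighted enstrophy bound ⇒ the crux, with the
schedule `Λ(2^K) ≤ A/(ν(K+1))`, `A = C_loc · κ₀ · sup E[W·Y] + Σ_K ‖Q_{2^K} f‖ R`. -/
def TransferCritical : Prop := FluxLocality → ReynoldsWeightedEnstrophy → ResolvedDissipation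

/-- Type-I ceiling ⇒ C⁺ (with `E[Y] ≤ ‖f‖R/ν` from the energy row). -/
def TransferTypeOne : Prop := TypeOneCeiling → ReynoldsWeightedEnstrophy

/-- `5/4`-moment ⇒ C⁺ (Bernstein + `Ḣ^{1/2}` interpolation + Hölder). -/
def TransferFiveFourths : Prop := FiveFourthsMoment → ReynoldsWeightedEnstrophy

/-- First lemma (volumetric face): flux locality + dimension floor `D > 1` ⇒ the crux, with a POLYNOMIAL
schedule and no Reynolds hypothesis (the cubic flux becomes `R · 2^{j(1−D)/2} · E[Z_j]`, energy class). -/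
def TransferVolumetric : Prop := FluxLocality → VolumetricFloor → ResolvedDissipation

/-- **The pigeonhole that makes a bound into a schedule** (proved): a non-increasing `ℝ≥0∞`-sequence lying
under a pointwise majorant `a` satisfies `(K+1) S_K ≤ Σ_{i ≤ K} a_i`; with `Σ_i a_i ≤ A` (the weighted flux
budget summed over octaves, which is what `ReynoldsWeightedEnstrophy` bounds) this is `S_K ≤ A/(K+1)`,
uniformly in whatever family `A` is uniform over. Applied to `S_K = sup_{N,μ} Λ_μ(2^K)` (tail enstrophy,
non-increasing in `K`). -/
theorem antitone_pigeonhole {S a : ℕ → ℝ≥0∞} (hS : Antitone S) (hle : ∀ K, S K ≤ a K) (K : ℕ) :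
    ((K : ℝ≥0∞) + 1) * S K ≤ ∑ i ∈ Finset.range (K + 1), a i := by
  have h1 : ∑ _i ∈ Finset.range (K + 1), S K = ((K : ℝ≥0∞) + 1) * S K := by
    rw [Finset.sum_const, Finset.card_range, nsmul_eq_mul]
    push_cast
    ring
  calc ((K : ℝ≥0∞) + 1) * S K = ∑ _i ∈ Finset.range (K + 1), S K := h1.symm
    _ ≤ ∑ i ∈ Finset.range (K + 1), S i :=
        Finset.sum_le_sum fun i hi => hS (Nat.lt_succ_iff.mp (Finset.mem_range.mp hi))
    _ ≤ ∑ i ∈ Finset.range (K + 1), a i := Finset.sum_le_sum fun i _ => hle i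

/-- Corollary in the form used by the line: a summable majorant gives the decay `S_K ≤ A / (K+1)`. -/
theorem antitone_le_div_of_sum_le {S a : ℕ → ℝ≥0∞} (hS : Antitone S) (hle : ∀ K, S K ≤ a K)
    {A : ℝ≥0∞} (hA : ∀ K, ∑ i ∈ Finset.range (K + 1), a i ≤ A) (K : ℕ) :
    S K ≤ A / ((K : ℝ≥0∞) + 1) := by
  have h := (antitone_pigeonhole hS hle K).trans (hA K)
  rw [ENNReal.le_div_iff_mul_le (Or.inl (by positivity)) (Or.inl (by simp)), mul_comm]
  exact h

end Summit.AnomalousDissipation.AnomalousDissipation.Cruxes.ResolvedDissipation.Ideate3G2
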